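import Literature.Computability.Complexity.Transducers
import Literature.Computability.Complexity.BoolEncodings
import Mathlib.Tactic.DeriveFintype
import Mathlib.Data.Fintype.Sigma
import Mathlib.Data.Fintype.Sum
import HarnessLib

/-!
# Brute-force `k`-SAT, counting stage: one transducer pass per assignment

Trunk `CplxCore` / family `fine-grained`. Second of the two finite-state machines of the
brute-force satisfiability decider behind `Literature.Computability.FineGrained.kSATInExpTime_one`
(`k`-SAT ∈ TIME(`2ⁿ · poly(L)`), Impagliazzo–Paturi 2001, §1: "`δ = 1` by exhaustive search").
The decider is a pipeline of finite-state transducer passes (`Transducers.lean`) iterated by the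
clocked loop machine (`TM2Iterate.lean`, `TM2IterateFST.lean`); this file is machine-free: it
defines the transducer of the **counting stage** and proves what its iterates compute.

State of the counting stage (a word over `CSym`): a mode symbol `mode done flag`, then the
clauses `bra … ket`, each literal being `v` *cells* followed by `head pol`; the cells of every
literal hold the same `v`-bit counter (least significant bit first), and the cell at the
position of the literal's own variable (its *rank* `< v`) is marked. One pass of `countFST`
(mode `run f`): in every literal, read the bit under the mark (the value of the literal's
variable under the current assignment), compare it with the polarity, increment the counter
(carry chain), and accumulate clause and formula satisfaction; the new mode is prepended
through `FST.front`: `done (f || sat)` if the counter overflowed (the assignment `1…1` has just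
been evaluated) or if there is no literal at all, else `run (f || sat)`. In mode `done` the pass
discards everything but the mode symbol.

Main results (pure list computations, no machines):

* `countFST_eval_runState`: one pass from the state of counter `bs` evaluates the formula under
  `bs` and steps the counter (`incrC`, a ripple-carry increment; its arithmetic is stated with
  `bitsToNat` of `BoolEncodings.lean`: `bitsToNat_incrC`, `bitsToNat_counter`);
* `countFST_iterate_done`: after `2 ^ v + e` passes from the all-zero counter the state is the
  single symbol `mode true b` with `b = decide (∃ bs, bs.length = v ∧ formVal bs sk)` — the
  formula skeleton `sk` (clauses of (rank, polarity)) is satisfiable by an assignment of its `v`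
  ranked variables;
* `length_iterate_countFST_le`: passes do not lengthen the state; `countFST_maxEmit_le`.

## References

* R. Impagliazzo, R. Paturi, *On the complexity of k-SAT*, JCSS 62 (2001) 367–375, §1
  (`s_k ≤ 1`: exhaustive search), doi:10.1006/jcss.2000.1727.
* J. E. Hopcroft, J. D. Ullman, *Introduction to Automata Theory, Languages, and Computation*,
  Addison-Wesley 1979, §2.7 (Mealy machines).
-/

namespace Literature.Computability.FineGrained.BruteForce

open Complexity

/-! ### Alphabet and transducer -/

/-- Symbols of the counting stage: the mode (`done?`, flag), clause brackets, a counter cell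
(marked?, bit) and the head of a literal (its polarity). [folklore] -/
inductive CSym
  | mode (done f : Bool)
  | bra
  | ket
  | cell (mk b : Bool)
  | head (pol : Bool)
  deriving DecidableEq, Fintype

/-- default symbol [folklore] -/
instance : Inhabited CSym := ⟨CSym.bra⟩

-- the derived `Fintype` proxy (nested sigma types over seven Booleans) exceeds the default
-- instance size bound
set_option synthInstance.maxSize 1024 in
/-- States of the counting transducer: before the mode symbol; inside the body (flag, a literal
was seen, overflow, all closed clauses satisfied, current clause satisfied, carry, bit under the
mark of the current literal); final (the input was already `done`). [folklore] -/
inductive CSt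
  | start
  | body (f sl ov al cl c lb : Bool)
  | fin (f : Bool)
  deriving DecidableEq, Fintype

/-- Transition function of the counting transducer. [folklore] -/
def countStep : CSt → CSym → CSt × List CSym
  | .start, .mode false f => (.body f false false true false true false, [])
  | .start, .mode true f => (.fin f, [])
  | .start, _ => (.start, [])
  | .body f sl ov al _ _ lb, .bra => (.body f sl ov al false true lb, [.bra])
  | .body f sl ov al cl c lb, .cell mk b =>
      (.body f sl ov al cl (b && c) (if mk then b else lb), [.cell mk (xor b c)])
  | .body f _ _ al cl c lb, .head pol => (.body f true c al (cl || (lb == pol)) true lb, [.head pol])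
  | .body f sl ov al cl c lb, .ket => (.body f sl ov (al && cl) cl c lb, [.ket])
  | .body f sl ov al cl c lb, .mode _ _ => (.body f sl ov al cl c lb, [])
  | .fin f, _ => (.fin f, [])

/-- The new mode symbol, prepended at the end of the pass. [folklore] -/
def countFront : CSt → List CSym
  | .start => []
  | .fin f => [.mode true f]
  | .body f sl ov al _ _ _ => [.mode (!sl || ov) (f || al)]

/-- **The counting transducer.** [folklore] -/
def countFST : FST CSt CSym CSym where
  init := .start
  step := countStep
  front := countFront
  keep s := match s with
    | .fin _ => false
    | .body _ sl ov _ _ _ _ => !(!sl || ov)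
    | .start => true

/-- Every transition emits at most one symbol. [folklore] -/
theorem countStep_length_le (s : CSt) (x : CSym) : (countStep s x).2.length ≤ 1 := by
  cases s <;> cases x <;> simp [countStep]
  split <;> simp

/-- `maxEmit countFST ≤ 1`. [folklore] -/
theorem countFST_maxEmit_le : countFST.maxEmit ≤ 1 :=
  Finset.sup_le fun p _ => countStep_length_le p.1 p.2

/-! ### Counters: bit lists, least significant bit first -/

/-- Increment with incoming carry `c`: the new bits and the outgoing carry. [folklore] -/
def incrC : Bool → List Bool → List Bool × Bool
  | c, [] => ([], c)
  | c, b :: bs => ((xor b c) :: (incrC (b && c) bs).1, (incrC (b && c) bs).2)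

/-- `incrC` on the empty counter: the carry passes through. [folklore] -/
@[simp] theorem incrC_nil (c : Bool) : incrC c [] = ([], c) := rfl
/-- `incrC` on a nonempty counter: one full-adder step. [folklore] -/
@[simp] theorem incrC_cons (c b : Bool) (bs : List Bool) :
    incrC c (b :: bs) = ((xor b c) :: (incrC (b && c) bs).1, (incrC (b && c) bs).2) := rfl

/-- Incrementing preserves the length. [folklore] -/
@[simp] theorem length_incrC (c : Bool) (bs : List Bool) : (incrC c bs).1.length = bs.length := by
  induction bs generalizing c with
  | nil => rfl
  | cons b bs ih => simp [ih]

/-- No carry in: nothing happens. [folklore] -/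
@[simp] theorem incrC_false (bs : List Bool) : incrC false bs = (bs, false) := by
  induction bs with
  | nil => rfl
  | cons b bs ih => simp [ih]

/-- **Increment is correct**: `bitsToNat bs' + carryOut · 2^|bs| = bitsToNat bs + carryIn`. [folklore] -/
theorem bitsToNat_incrC (c : Bool) (bs : List Bool) :
    bitsToNat (incrC c bs).1 + (incrC c bs).2.toNat * 2 ^ bs.length = bitsToNat bs + c.toNat := by
  induction bs generalizing c with
  | nil => simp
  | cons b bs ih =>
    have := ih (b && c)
    simp only [incrC_cons, bitsToNat_cons, List.length_cons, pow_succ]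
    generalize (incrC (b && c) bs).2 = co at this ⊢
    generalize bitsToNat (incrC (b && c) bs).1 = m at this ⊢
    cases co <;> cases b <;> cases c <;> simp at this ⊢ <;> omega

/-- `bitsToNat` is injective on lists of equal length. [folklore] -/
theorem bitsToNat_injective_of_length_eq {bs bs' : List Bool} (hl : bs.length = bs'.length)
    (h : bitsToNat bs = bitsToNat bs') : bs = bs' := by
  induction bs generalizing bs' with
  | nil => cases bs' <;> simp_all
  | cons b bs ih =>
    cases bs' with
    | nil => simp at hl
    | cons b' bs' =>
      simp only [bitsToNat_cons] at h
      simp only [List.length_cons, Nat.add_right_cancel_iff] at hl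
      have hb : b = b' := by
        cases b <;> cases b' <;> simp at h ⊢ <;> omega
      subst hb
      have : bitsToNat bs = bitsToNat bs' := by omega
      rw [ih hl this]

/-- The `t`-th counter value: `t` increments of the all-zero counter of width `v`. [folklore] -/
def counter (v t : ℕ) : List Bool :=
  (fun bs => (incrC true bs).1)^[t] (List.replicate v false)

/-- The `0`-th counter value is all-zero. [folklore] -/
@[simp] theorem counter_zero (v : ℕ) : counter v 0 = List.replicate v false := rfl

/-- The next counter value is the increment. [folklore] -/
theorem counter_succ (v t : ℕ) : counter v (t + 1) = (incrC true (counter v t)).1 := by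
  rw [counter, Function.iterate_succ_apply']; rfl

/-- Counter values have width `v`. [folklore] -/
@[simp] theorem length_counter (v t : ℕ) : (counter v t).length = v := by
  induction t with
  | zero => simp
  | succ t ih => rw [counter_succ, length_incrC, ih]

/-- Below `2 ^ v` the counter counts: `bitsToNat (counter v t) = t`. [folklore] -/
theorem bitsToNat_counter {v t : ℕ} (ht : t < 2 ^ v) : bitsToNat (counter v t) = t := by
  induction t with
  | zero => simp
  | succ t ih =>
    have ih := ih (by omega)
    have h := bitsToNat_incrC true (counter v t)
    rw [length_counter, ih] at h
    rw [counter_succ]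
    have hlt := bitsToNat_lt (incrC true (counter v t)).1
    rw [length_incrC, length_counter] at hlt
    cases hco : (incrC true (counter v t)).2 <;> simp [hco] at h <;> omega

/-- The counter overflows exactly when stepping from `2 ^ v - 1`. [folklore] -/
theorem incrC_counter_snd {v t : ℕ} (ht : t < 2 ^ v) :
    (incrC true (counter v t)).2 = decide (t + 1 = 2 ^ v) := by
  have h := bitsToNat_incrC true (counter v t)
  rw [length_counter, bitsToNat_counter ht] at h
  have hlt := bitsToNat_lt (incrC true (counter v t)).1
  rw [length_incrC, length_counter] at hlt
  cases hco : (incrC true (counter v t)).2 <;> simp [hco] at h ⊢ <;> omega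

/-- Every bit list of length `v` is a counter value below `2 ^ v`. [folklore] -/
theorem exists_counter_eq {v : ℕ} {bs : List Bool} (h : bs.length = v) :
    ∃ t < 2 ^ v, counter v t = bs := by
  refine ⟨bitsToNat bs, h ▸ bitsToNat_lt bs, bitsToNat_injective_of_length_eq (by simp [h]) ?_⟩
  exact bitsToNat_counter (h ▸ bitsToNat_lt bs)

/-! ### The encoded state and the formula skeleton -/

/-- The cells of a literal of rank `j` holding the counter `bs`: the `j`-th cell is marked.
[folklore] -/
def cells : ℕ → List Bool → List CSym
  | _, [] => []
  | 0, b :: bs => .cell true b :: bs.map (.cell false)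
  | j + 1, b :: bs => .cell false b :: cells j bs

/-- No cells for the empty counter. [folklore] -/
@[simp] theorem cells_nil (j : ℕ) : cells j [] = [] := by cases j <;> rfl
/-- Rank `0`: the first cell is marked, the others are not. [folklore] -/
@[simp] theorem cells_zero_cons (b : Bool) (bs : List Bool) :
    cells 0 (b :: bs) = .cell true b :: bs.map (.cell false) := rfl
/-- Rank `j + 1`: the first cell is unmarked. [folklore] -/
@[simp] theorem cells_succ_cons (j : ℕ) (b : Bool) (bs : List Bool) :
    cells (j + 1) (b :: bs) = .cell false b :: cells j bs := rfl

/-- One cell per counter bit. [folklore] -/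
@[simp] theorem length_cells (j : ℕ) (bs : List Bool) : (cells j bs).length = bs.length := by
  induction bs generalizing j with
  | nil => simp
  | cons b bs ih => cases j <;> simp [ih]

/-- A formula skeleton: clauses of literals `(rank, polarity)`. [folklore] -/
abbrev Skeleton : Type := List (List (ℕ × Bool))

/-- Encoding of a literal: its cells, then its head. [folklore] -/
def litEnc (bs : List Bool) (l : ℕ × Bool) : List CSym := cells l.1 bs ++ [.head l.2]

/-- Encoding of a clause. [folklore] -/
def clauseEnc (bs : List Bool) (c : List (ℕ × Bool)) : List CSym :=
  .bra :: (c.flatMap (litEnc bs) ++ [.ket])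

/-- Encoding of the body (all clauses). [folklore] -/
def bodyEnc (bs : List Bool) (sk : Skeleton) : List CSym := sk.flatMap (clauseEnc bs)

/-- `bodyEnc` of no clause. [folklore] -/
@[simp] theorem bodyEnc_nil (bs : List Bool) : bodyEnc bs [] = [] := rfl

/-- `bodyEnc` clause by clause. [folklore] -/
theorem bodyEnc_cons (bs : List Bool) (c : List (ℕ × Bool)) (sk : Skeleton) :
    bodyEnc bs (c :: sk) = clauseEnc bs c ++ bodyEnc bs sk := rfl

/-- The running state of the counting stage: mode `run f`, then the body. [folklore] -/
def runState (f : Bool) (bs : List Bool) (sk : Skeleton) : List CSym :=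
  .mode false f :: bodyEnc bs sk

/-- Value of a literal `(j, pol)` under the assignment `bs` (bit `j`, default `false`).
[folklore] -/
def litVal (bs : List Bool) (l : ℕ × Bool) : Bool := bs.getD l.1 false == l.2

/-- Value of a clause: some literal is true. [folklore] -/
def clauseVal (bs : List Bool) (c : List (ℕ × Bool)) : Bool := c.any (litVal bs)

/-- Value of the formula: all clauses are true. [folklore] -/
def formVal (bs : List Bool) (sk : Skeleton) : Bool := sk.all (clauseVal bs)

/-- Does the skeleton contain a literal? [folklore] -/
def hasLit (sk : Skeleton) : Bool := sk.any fun c => !c.isEmpty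

/-- `hasLit` clause by clause. [folklore] -/
@[simp] theorem hasLit_cons (c : List (ℕ × Bool)) (sk : Skeleton) :
    hasLit (c :: sk) = (!c.isEmpty || hasLit sk) := rfl

/-- `formVal` clause by clause. [folklore] -/
@[simp] theorem formVal_cons (bs : List Bool) (c : List (ℕ × Bool)) (sk : Skeleton) :
    formVal bs (c :: sk) = (clauseVal bs c && formVal bs sk) := rfl

/-- Well-formedness: all ranks are below the counter width. [folklore] -/
def WF (v : ℕ) (sk : Skeleton) : Prop := ∀ c ∈ sk, ∀ l ∈ c, l.1 < v

/-! ### One pass: run lemmas -/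

section Run


/-- The transducer's step is `countStep`. [folklore] -/
theorem countFST_step (s : CSt) (x : CSym) : countFST.step s x = countStep s x := rfl

/-- The transducer starts in `start`. [folklore] -/
theorem countFST_init : countFST.init = CSt.start := rfl

/-- Cells without a mark are incremented; the state tracks the carry. [folklore] -/
theorem run_map_cell (f sl ov al cl c lb : Bool) (bs : List Bool) (rest : List CSym) :
    countFST.run (.body f sl ov al cl c lb) (bs.map (.cell false) ++ rest) =
      ((countFST.run (.body f sl ov al cl (incrC c bs).2 lb) rest).1,
        (incrC c bs).1.map (.cell false) ++ (countFST.run (.body f sl ov al cl (incrC c bs).2 lb) rest).2) := by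
  induction bs generalizing c with
  | nil => simp
  | cons b bs ih =>
    rw [List.map_cons, List.cons_append, FST.run_cons, countFST_step]
    simp only [countStep, Bool.false_eq_true, ↓reduceIte]
    rw [ih]
    simp

/-- The cells of a literal of rank `j < |bs|`: incremented, and the bit under the mark is
recorded. [folklore] -/
theorem run_counterCells (f sl ov al cl c lb : Bool) (j : ℕ) (bs : List Bool) (hj : j < bs.length)
    (rest : List CSym) :
    countFST.run (.body f sl ov al cl c lb) (cells j bs ++ rest) =
      ((countFST.run (.body f sl ov al cl (incrC c bs).2 (bs.getD j false)) rest).1,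
        cells j (incrC c bs).1 ++ (countFST.run (.body f sl ov al cl (incrC c bs).2 (bs.getD j false)) rest).2) := by
  induction bs generalizing j c lb with
  | nil => simp at hj
  | cons b bs ih =>
    cases j with
    | zero =>
      rw [cells_zero_cons, List.cons_append, FST.run_cons, countFST_step]
      simp only [countStep, ↓reduceIte]
      rw [run_map_cell]
      simp
    | succ j =>
      rw [cells_succ_cons, List.cons_append, FST.run_cons, countFST_step]
      simp only [countStep, Bool.false_eq_true, ↓reduceIte]
      rw [ih (j := j) (c := b && c) (lb := lb) (by simpa using hj)]
      simp

/-- One literal `(j, pol)` with `j < |bs|`, entered with carry `true`. [folklore] -/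
theorem run_litEnc (f sl ov al cl lb : Bool) (l : ℕ × Bool) (bs : List Bool) (hj : l.1 < bs.length)
    (rest : List CSym) :
    countFST.run (.body f sl ov al cl true lb) (litEnc bs l ++ rest) =
      ((countFST.run (.body f true (incrC true bs).2 al (cl || litVal bs l) true (bs.getD l.1 false)) rest).1,
        litEnc (incrC true bs).1 l ++
          (countFST.run (.body f true (incrC true bs).2 al (cl || litVal bs l) true (bs.getD l.1 false)) rest).2) := by
  rw [litEnc, List.append_assoc, run_counterCells _ _ _ _ _ _ _ _ _ hj, List.singleton_append, FST.run_cons,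
    countFST_step]
  simp [countStep, litEnc, litVal]

/-- The literals of a clause (all ranks `< |bs|`), entered with carry `true`: the clause value
is accumulated; if the clause is nonempty a literal was seen and the overflow bit is the carry
out of the increment. [folklore] -/
theorem run_lits (f sl ov al cl lb : Bool) (c : List (ℕ × Bool)) (bs : List Bool)
    (hc : ∀ l ∈ c, l.1 < bs.length) (rest : List CSym) :
    ∃ lb' : Bool,
      countFST.run (.body f sl ov al cl true lb) (c.flatMap (litEnc bs) ++ rest) =
        ((countFST.run (.body f (sl || !c.isEmpty) (if c.isEmpty then ov else (incrC true bs).2) al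
            (cl || clauseVal bs c) true lb') rest).1,
          c.flatMap (litEnc (incrC true bs).1) ++
            (countFST.run (.body f (sl || !c.isEmpty) (if c.isEmpty then ov else (incrC true bs).2) al
              (cl || clauseVal bs c) true lb') rest).2) := by
  induction c generalizing sl ov cl lb with
  | nil => exact ⟨lb, by simp [clauseVal]⟩
  | cons l c ih =>
    have hl : l.1 < bs.length := hc l (by simp)
    obtain ⟨lb', h⟩ := ih true (incrC true bs).2 (cl || litVal bs l) (bs.getD l.1 false)
      (fun l' hl' => hc l' (by simp [hl']))
    refine ⟨lb', ?_⟩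
    rw [List.flatMap_cons, List.append_assoc, run_litEnc _ _ _ _ _ _ _ _ hl, h]
    cases hce : c.isEmpty <;> simp [clauseVal, Bool.or_assoc]

/-- One clause. [folklore] -/
theorem run_clauseEnc (f sl ov al cl c₀ lb : Bool) (c : List (ℕ × Bool)) (bs : List Bool)
    (hc : ∀ l ∈ c, l.1 < bs.length) (rest : List CSym) :
    ∃ cl' c' lb', countFST.run (.body f sl ov al cl c₀ lb) (clauseEnc bs c ++ rest) =
        ((countFST.run (.body f (sl || !c.isEmpty) (if c.isEmpty then ov else (incrC true bs).2)
            (al && clauseVal bs c) cl' c' lb') rest).1,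
          clauseEnc (incrC true bs).1 c ++
            (countFST.run (.body f (sl || !c.isEmpty) (if c.isEmpty then ov else (incrC true bs).2)
              (al && clauseVal bs c) cl' c' lb') rest).2) := by
  obtain ⟨lb', h⟩ := run_lits f sl ov al false lb c bs hc (.ket :: rest)
  refine ⟨clauseVal bs c, true, lb', ?_⟩
  rw [clauseEnc, List.cons_append, FST.run_cons, countFST_step]
  simp only [countStep, List.append_assoc, List.singleton_append]
  rw [h, FST.run_cons, countFST_step]
  simp [countStep, clauseEnc]

/-- The whole body. [folklore] -/
theorem run_bodyEnc (f sl ov al cl c₀ lb : Bool) (sk : Skeleton) (bs : List Bool)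
    (hwf : WF bs.length sk) :
    ∃ cl' c' lb', countFST.run (.body f sl ov al cl c₀ lb) (bodyEnc bs sk) =
        (.body f (sl || hasLit sk) (if hasLit sk then (incrC true bs).2 else ov)
            (al && formVal bs sk) cl' c' lb',
          bodyEnc (incrC true bs).1 sk) := by
  induction sk generalizing sl ov al cl c₀ lb with
  | nil => exact ⟨cl, c₀, lb, by simp [hasLit, formVal]⟩
  | cons c sk ih =>
    obtain ⟨cl', c', lb', h⟩ := run_clauseEnc f sl ov al cl c₀ lb c bs
      (fun l hl => hwf c (by simp) l hl) (bodyEnc bs sk)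
    obtain ⟨cl'', c'', lb'', h'⟩ := ih (sl || !c.isEmpty) (if c.isEmpty then ov else (incrC true bs).2)
      (al && clauseVal bs c) cl' c' lb' (fun c' hc' => hwf c' (by simp [hc']))
    refine ⟨cl'', c'', lb'', ?_⟩
    rw [bodyEnc_cons, h, h', bodyEnc_cons]
    simp only [Prod.mk.injEq, and_true, hasLit_cons, formVal_cons]
    clear h h'
    rcases Bool.eq_false_or_eq_true c.isEmpty with hce | hce <;>
      rcases Bool.eq_false_or_eq_true (hasLit sk) with hh | hh <;>
        simp [hce, hh, Bool.and_assoc]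

end Run

/-! ### One pass: the transduction -/

/-- **One pass of the counting stage.** From mode `run f` with counter `bs`: the formula is
evaluated under `bs`, the flag updated, the counter incremented; the pass ends the stage
(`mode true`) iff the counter overflowed or there is no literal. [folklore] -/
theorem countFST_eval_runState (f : Bool) (bs : List Bool) (sk : Skeleton) (hwf : WF bs.length sk) :
    countFST.eval (runState f bs sk) =
      if hasLit sk && !(incrC true bs).2 then runState (f || formVal bs sk) (incrC true bs).1 sk
      else [.mode true (f || formVal bs sk)] := by
  obtain ⟨cl', c', lb', h⟩ := run_bodyEnc f false false true false true false sk bs hwf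
  have hrun : countFST.run countFST.init (runState f bs sk) =
      (.body f (hasLit sk) (if hasLit sk then (incrC true bs).2 else false) (formVal bs sk) cl' c' lb',
        bodyEnc (incrC true bs).1 sk) := by
    rw [runState, FST.run_cons, countFST_init, countFST_step]
    change ((countFST.run (CSt.body f false false true false true false) (bodyEnc bs sk)).1,
      [] ++ (countFST.run (CSt.body f false false true false true false) (bodyEnc bs sk)).2) = _
    rw [h]; simp
  rw [FST.eval, hrun]
  cases hh : hasLit sk <;> cases hco : (incrC true bs).2 <;>
    simp [countFST, countFront, runState]

/-- In mode `done` the pass keeps the mode symbol only. [folklore] -/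
theorem countFST_eval_done (f : Bool) (rest : List CSym) :
    countFST.eval (.mode true f :: rest) = [.mode true f] := by
  have hrun : ∀ s : CSt, (∃ f, s = .fin f) → ∀ l : List CSym, countFST.run s l = (s, []) := by
    rintro s ⟨f, rfl⟩ l
    induction l with
    | nil => rfl
    | cons x l ih => rw [FST.run_cons, countFST_step]; cases x <;> simp [countStep, ih]
  rw [FST.eval, FST.run_cons, countFST_init, countFST_step]
  simp only [countStep]
  rw [hrun _ ⟨f, rfl⟩]
  simp [countFST, countFront]

/-- Iterating in mode `done` changes nothing. [folklore] -/
theorem countFST_iterate_done_mode (f : Bool) (e : ℕ) :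
    countFST.eval^[e] [.mode true f] = [.mode true f] := by
  induction e with
  | zero => rfl
  | succ e ih => rw [Function.iterate_succ_apply, countFST_eval_done, ih]

/-! ### Iterating the pass -/

/-- **The passes enumerate the assignments.** With at least one literal, after `t < 2 ^ v`
passes from the all-zero counter the state is `run` with counter `counter v t` and flag
"some earlier assignment satisfied the formula". [folklore] -/
theorem countFST_iterate_runState {v : ℕ} (sk : Skeleton) (hwf : WF v sk) (hlit : hasLit sk = true)
    {t : ℕ} (ht : t < 2 ^ v) :
    countFST.eval^[t] (runState false (List.replicate v false) sk) =
      runState (decide (∃ r < t, formVal (counter v r) sk = true)) (counter v t) sk := by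
  induction t with
  | zero => simp
  | succ t ih =>
    rw [Function.iterate_succ_apply', ih (by omega),
      countFST_eval_runState _ _ _ (by rw [length_counter]; exact hwf),
      incrC_counter_snd (by omega), hlit, ← counter_succ]
    have hne : ¬ (t + 1 = 2 ^ v) := by omega
    simp only [hne, decide_false, Bool.not_false, Bool.and_self, ↓reduceIte]
    congr 1
    rw [Bool.eq_iff_iff]
    simp only [Bool.or_eq_true, decide_eq_true_eq]
    constructor
    · rintro (⟨r, hr, h⟩ | h)
      · exact ⟨r, by omega, h⟩
      · exact ⟨t, by omega, h⟩
    · rintro ⟨r, hr, h⟩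
      rcases Nat.lt_succ_iff_lt_or_eq.mp hr with hr | rfl
      · exact Or.inl ⟨r, hr, h⟩
      · exact Or.inr h

/-- Without literals the value of the formula does not depend on the assignment (every clause
is empty, hence false; the formula is true iff there is no clause). [folklore] -/
theorem formVal_eq_of_hasLit (sk : Skeleton) (h : hasLit sk = false) (bs bs' : List Bool) :
    formVal bs sk = formVal bs' sk := by
  induction sk with
  | nil => rfl
  | cons c sk ih =>
    simp only [hasLit, List.any_cons, Bool.or_eq_false_iff, Bool.not_eq_false',
      List.isEmpty_iff] at h
    obtain ⟨rfl, h'⟩ := h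
    simp [formVal, clauseVal]

/-- **The counting stage decides satisfiability of the skeleton.** After `2 ^ v + e` passes
from the all-zero counter of width `v` (all ranks `< v`), the state is the single symbol
`mode true b`, `b` telling whether some counter value below `2 ^ v` — equivalently
(`exists_counter_formVal_iff`) some assignment of the `v` variables — satisfies the skeleton.
[cite: ImpagliazzoPaturiJCSS2001, §1 (s_k ≤ 1 by exhaustive search)] -/
theorem countFST_iterate_done {v : ℕ} (sk : Skeleton) (hwf : WF v sk) (e : ℕ) :
    countFST.eval^[2 ^ v + e] (runState false (List.replicate v false) sk) =
      [.mode true (decide (∃ r < 2 ^ v, formVal (counter v r) sk = true))] := by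
  have hpos : 0 < 2 ^ v := Nat.two_pow_pos v
  rw [Nat.add_comm, Function.iterate_add_apply]
  cases hlit : hasLit sk with
  | false =>
    -- no literal: the first pass already ends the stage
    obtain ⟨n, hn⟩ : ∃ n, 2 ^ v = n + 1 := ⟨2 ^ v - 1, by omega⟩
    rw [hn, Function.iterate_succ_apply,
      countFST_eval_runState _ _ _ (by rw [List.length_replicate]; exact hwf), hlit]
    simp only [Bool.false_and, Bool.false_eq_true, ↓reduceIte, Bool.false_or]
    rw [countFST_iterate_done_mode, countFST_iterate_done_mode]
    congr 2
    rw [Bool.eq_iff_iff, decide_eq_true_iff]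
    constructor
    · intro h; exact ⟨0, by omega, by rwa [counter_zero]⟩
    · rintro ⟨r, -, h⟩; rwa [formVal_eq_of_hasLit sk hlit _ (counter v r)]
  | true =>
    obtain ⟨n, hn⟩ : ∃ n, 2 ^ v = n + 1 := ⟨2 ^ v - 1, by omega⟩
    rw [hn, Function.iterate_succ_apply', countFST_iterate_runState sk hwf hlit (by omega),
      countFST_eval_runState _ _ _ (by rw [length_counter]; exact hwf),
      incrC_counter_snd (by omega), hlit]
    simp only [hn, decide_true, Bool.not_true, Bool.and_false, Bool.false_eq_true, ↓reduceIte]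
    rw [countFST_iterate_done_mode]
    congr 2
    rw [Bool.eq_iff_iff]
    simp only [Bool.or_eq_true, decide_eq_true_eq]
    constructor
    · rintro (⟨r, hr, h⟩ | h)
      · exact ⟨r, by omega, h⟩
      · exact ⟨n, by omega, h⟩
    · rintro ⟨r, hr, h⟩
      rcases Nat.lt_succ_iff_lt_or_eq.mp hr with hr | rfl
      · exact Or.inl ⟨r, hr, h⟩
      · exact Or.inr h

/-- The decided property, as a statement about assignments: some bit list of length `v`
satisfies the skeleton. [folklore] -/
theorem exists_counter_formVal_iff (v : ℕ) (sk : Skeleton) :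
    (∃ r < 2 ^ v, formVal (counter v r) sk = true) ↔
      ∃ bs : List Bool, bs.length = v ∧ formVal bs sk = true := by
  constructor
  · rintro ⟨r, -, h⟩
    exact ⟨_, length_counter v r, h⟩
  · rintro ⟨bs, hbs, h⟩
    obtain ⟨t, ht, rfl⟩ := exists_counter_eq hbs
    exact ⟨t, ht, h⟩

/-- Beyond `2 ^ v` passes the state is the final mode symbol, whatever the excess. [folklore] -/
theorem countFST_iterate_of_le {v : ℕ} (sk : Skeleton) (hwf : WF v sk) {N : ℕ} (hN : 2 ^ v ≤ N) :
    countFST.eval^[N] (runState false (List.replicate v false) sk) =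
      [.mode true (decide (∃ r < 2 ^ v, formVal (counter v r) sk = true))] := by
  obtain ⟨e, rfl⟩ := Nat.exists_eq_add_of_le hN
  exact countFST_iterate_done sk hwf e

/-! ### Size of the iterates -/

/-- The running state has the length of the initial state (counters have constant width).
[folklore] -/
theorem length_runState (f : Bool) (bs : List Bool) (sk : Skeleton) :
    (runState f bs sk).length = (runState false (List.replicate bs.length false) sk).length := by
  simp [runState, bodyEnc, clauseEnc, litEnc, List.length_flatMap]

/-- **No pass lengthens the state** (from the initial state of width `v`). [folklore] -/
theorem length_iterate_countFST_le {v : ℕ} (sk : Skeleton) (hwf : WF v sk) (t : ℕ) :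
    (countFST.eval^[t] (runState false (List.replicate v false) sk)).length ≤
      (runState false (List.replicate v false) sk).length := by
  by_cases ht : t < 2 ^ v
  · cases hlit : hasLit sk with
    | true =>
      rw [countFST_iterate_runState sk hwf hlit ht, length_runState, length_counter]
    | false =>
      cases t with
      | zero => exact le_rfl
      | succ t =>
        rw [Function.iterate_succ_apply,
          countFST_eval_runState _ _ _ (by rw [List.length_replicate]; exact hwf), hlit]
        simp only [Bool.false_and, Bool.false_eq_true, ↓reduceIte, Bool.false_or]
        rw [countFST_iterate_done_mode]
        simp [runState]
  · rw [countFST_iterate_of_le sk hwf (not_lt.mp ht)]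
    simp [runState]

end Literature.Computability.FineGrained.BruteForce
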